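import Summits.QuantumFields.GaugeBoot.TiltedBoxLimitInPlaneLinkRP
import Summits.QuantumFields.GaugeBoot.TiltedBoxLimitPermutationGroup
import Summits.QuantumFields.GaugeBoot.TiltedBoxLimitClass
import HarnessLib

/-!
# Infinite-volume limit points of the 45°-tilted boxes, part 18: odd-family limit points in two dimensions are Class B

HONEST FRAMING (cell `pub-gaugeboot`, page 1 of every file): the venture produces certified bounds
on lattice expectations at stated coupling, gauge group, dimension and torus size; NOT a mass gap,
NOT a continuum limit, NOT a string tension; NOT Yang–Mills-summit-bearing (barriers
`FixedCouplingUltralocality`, `PerturbativeInvisibility`). This module packages structural facts about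
a class of infinite-volume Wilson states of TWO-dimensional lattice gauge theory (which SDP constraints
are exact for them, and that the class is inhabited); it bounds nothing and says nothing about `d ≥ 3`.

## Content

`ClassB.lean` lists what a loop-equation SDP with all three reflection-positivity families consumes
(`ClassBState`: probability, translation invariance, invariance under every axis permutation and every
axis reflection, the one-link Haar-shift identity, site/link RP along every axis, diagonal RP in every
plane). In two dimensions (`∀ k, k = i ∨ k = j`) a tilted limit point `μ ∈ tiltedBoxLimitPoints d i j ρ β`
along (frequently) ODD square boxes has ALL of them (`β ≥ 0`):

* translation / `(i j)` / reflection invariance, Haar shift, diagonal RP in the plane `x_i = x_j`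
  (parts 3–6, `TiltedBoxLimitClass.lean`); every axis permutation of `Fin d` fixes or exchanges `i`, `j`
  (`perm_fix_or_swap_of_two`), so part 14 gives invariance under all of them; diagonal RP for the pair
  `(j, i)` — the half `{x_j ≥ x_i}` — is conjugate to the pair `(i, j)` by the symmetry `(i j)` of `μ`
  (`diagRP'_of_mem_tiltedBoxLimitPoints`, every `d`);
* site RP along both axes (part 16, odd family) and link RP along both axes (part 17, every family).

* **`classBStateOfTiltedOdd`** / `classBStateOfTiltedOdd_μ` — the resulting `ClassBState d ρ β` with
  measure `μ`; **`exists_classBState_eq_of_isTiltedBoxLimitAlong_odd`**;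
* **`exists_classBState_mem_tiltedBoxLimitPoints`** — in two dimensions, at every `β ≥ 0`, some tilted
  limit point is (the measure of) a Class-B state: the TILTED route reaches Class B unconditionally in
  `d = 2` (the cubic-torus route does too, `thermodynamicLimitIsClassB_two`; whether the two classes of
  limit points coincide is the uniqueness question, not touched); `nonempty_classBState_of_two`.

Even-family two-dimensional tilted limit points are link-RP along both axes (part 17) but their site RP
along `i`, `j` is not established here (the even box's site mirror twists a layer).

References: K. Osterwalder, E. Seiler, Ann. Phys. 110 (1978) 440, §2; J. Fröhlich, R. Israel,
E. H. Lieb, B. Simon, J. Stat. Phys. 22 (1980) 297, §3; V. Kazakov, Z. Zheng, arXiv:2203.11360 §3.1,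
arXiv:2404.16925 §3.2; S. Friedli, Y. Velenik (2017) Ch. 10.
-/

noncomputable section

open MeasureTheory Filter Topology
open scoped ComplexOrder ComplexConjugate Pointwise
open Literature.Probability.LatticeModels (Site)
open Literature.MathematicalPhysics.QuantumLattice

namespace Summit.QuantumFields.GaugeBoot

namespace TiltedRP

variable {d : ℕ} {i j : Fin d} {N : ℕ}
variable {G : Type*} [Group G] [TopologicalSpace G] [IsTopologicalGroup G] [CompactSpace G]
  [MeasurableSpace G] [BorelSpace G] [SecondCountableTopology G]
variable (ρ : G →* Matrix (Fin N) (Fin N) ℂ)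

/-! ## Two axes: every permutation fixes or exchanges them -/

omit [Group G] [TopologicalSpace G] [IsTopologicalGroup G] [CompactSpace G] [MeasurableSpace G] [BorelSpace G]
  [SecondCountableTopology G] in
/-- In two dimensions (`∀ k, k = i ∨ k = j`, `i ≠ j`) every permutation of the axes fixes both `i`, `j`
or exchanges them. -/
theorem perm_fix_or_swap_of_two (hij : i ≠ j) (hd : ∀ k : Fin d, k = i ∨ k = j) (σ : Equiv.Perm (Fin d)) :
    σ i = i ∧ σ j = j ∨ σ i = j ∧ σ j = i := by
  rcases hd (σ i) with h1 | h1 <;> rcases hd (σ j) with h2 | h2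
  · exact absurd (σ.injective (h1.trans h2.symm)) hij
  · exact Or.inl ⟨h1, h2⟩
  · exact Or.inr ⟨h1, h2⟩
  · exact absurd (σ.injective (h1.trans h2.symm)) hij

/-! ## Diagonal RP for the reversed pair `(j, i)` -/

omit [Group G] [TopologicalSpace G] [IsTopologicalGroup G] [CompactSpace G] [MeasurableSpace G] [BorelSpace G]
  [SecondCountableTopology G] in
/-- The diagonal swap of configurations is the axis transposition `(i j)` (as maps). -/
theorem configDiagSwapZd_eq_configPerm_swap' (i j : Fin d) (U : LGConfig d G) :
    configDiagSwapZd i j U = configPerm (Equiv.swap i j) U := by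
  funext e
  simp only [configDiagSwapZd, configPerm, Equiv.symm_swap]
  rfl

omit [Group G] [TopologicalSpace G] [IsTopologicalGroup G] [CompactSpace G] [MeasurableSpace G] [BorelSpace G]
  [SecondCountableTopology G] in
/-- The diagonal mirror of the pair `(j, i)` is conjugate (indeed equal) to the one of `(i, j)` by `(i j)`. -/
theorem configDiagSwapZd_eq_conj_swap (i j : Fin d) (U : LGConfig d G) :
    configDiagSwapZd j i U =
      configPerm (Equiv.swap i j) (configDiagSwapZd i j (configPerm (Equiv.swap i j) U)) := by
  rw [configDiagSwapZd_eq_configPerm_swap', configDiagSwapZd_eq_configPerm_swap', configPerm_swap_configPerm_swap',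
    Equiv.swap_comm]

omit [Group G] [TopologicalSpace G] [IsTopologicalGroup G] [CompactSpace G] [MeasurableSpace G] [BorelSpace G]
  [SecondCountableTopology G] in
/-- Observables of the diagonal half `{x_j ≥ x_i}` pull back under `(i j)` to observables of `{x_i ≥ x_j}`. -/
theorem dependsOn_comp_configPerm_swap_diagHalf (i j : Fin d) (F : LGConfig d G → ℂ)
    (hF : DependsOn F (diagHalfEdges j i)) :
    DependsOn (F ∘ configPerm (Equiv.swap i j)) (diagHalfEdges i j) := by
  intro U V hUV
  simp only [Function.comp_apply]
  apply hF
  intro e he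
  simp only [configPerm, Equiv.symm_swap]
  apply hUV
  obtain ⟨h1, h2⟩ := he
  show (e.1 ∘ ⇑(Equiv.swap i j)) j ≤ (e.1 ∘ ⇑(Equiv.swap i j)) i ∧
    (Equiv.swap i j e.2 = j → (e.1 ∘ ⇑(Equiv.swap i j)) j + 1 ≤ (e.1 ∘ ⇑(Equiv.swap i j)) i)
  simp only [Function.comp_apply, Equiv.swap_apply_left, Equiv.swap_apply_right]
  refine ⟨h1, fun hk => h2 ?_⟩
  rw [Equiv.swap_apply_eq_iff, Equiv.swap_apply_right] at hk
  exact hk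

variable [T2Space G]

/-- **Diagonal RP of a tilted limit point for the reversed pair `(j, i)`** (the half `{x_j ≥ x_i}`;
`β ≥ 0`, `i ≠ j`, every `d`): conjugate the `(i, j)` statement (part 3) by the symmetry `(i j)` of `μ`. -/
theorem diagRP'_of_mem_tiltedBoxLimitPoints (hij : i ≠ j) (hρ : Continuous ρ) {β : ℝ} (hβ : 0 ≤ β)
    {μ : Measure (LGConfig d G)} (hμ : μ ∈ tiltedBoxLimitPoints d i j ρ β) :
    IsReflectionPositiveFor (configDiagSwapZd (G := G) j i) (diagHalfEdges j i) μ :=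
  IsReflectionPositiveFor.of_conj
    (measurePreserving_configPerm_swap_of_mem_tiltedBoxLimitPoints ρ hij hρ hμ)
    DiagRP.measurable_configDiagSwapZd (configPerm_swap_configPerm_swap' i j)
    (configDiagSwapZd_eq_conj_swap i j) (dependsOn_comp_configPerm_swap_diagHalf i j)
    (diagRP_of_mem_tiltedBoxLimitPoints ρ hij hρ hβ hμ)

/-- **Diagonal RP of a two-dimensional tilted limit point in every plane** (both ordered pairs of the
two axes): the `diagRP` field of `ClassBState`. -/
theorem diagRP_all_of_mem_tiltedBoxLimitPoints (hij : i ≠ j) (hd : ∀ k : Fin d, k = i ∨ k = j)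
    (hρ : Continuous ρ) {β : ℝ} (hβ : 0 ≤ β) {μ : Measure (LGConfig d G)}
    (hμ : μ ∈ tiltedBoxLimitPoints d i j ρ β) (a b : Fin d) (hab : a ≠ b) :
    IsReflectionPositiveFor (configDiagSwapZd (G := G) a b) (diagHalfEdges a b) μ := by
  rcases hd a with rfl | rfl <;> rcases hd b with rfl | rfl
  · exact absurd rfl hab
  · exact diagRP_of_mem_tiltedBoxLimitPoints ρ hij hρ hβ hμ
  · exact diagRP'_of_mem_tiltedBoxLimitPoints ρ hij hρ hβ hμ
  · exact absurd rfl hab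

/-! ## Odd-family two-dimensional tilted limit points are Class B -/

/-- **The Class-B state of a two-dimensional tilted limit point along (frequently) odd boxes** (`β ≥ 0`,
`i ≠ j` exhausting the axes, compact Hausdorff second countable `G`, continuous `ρ`): every field of
`ClassBState` holds for it. -/
def classBStateOfTiltedOdd (hij : i ≠ j) (hd : ∀ k : Fin d, k = i ∨ k = j) (hρ : Continuous ρ)
    {β : ℝ} (hβ : 0 ≤ β) {M Q : ℕ → ℕ} {μ : Measure (LGConfig d G)}
    (h : IsTiltedBoxLimitAlong d i j ρ β M Q μ) (hM : Tendsto M atTop atTop) (hQ : Tendsto Q atTop atTop)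
    (hodd : ∃ᶠ k in atTop, Odd (M k + 2)) : ClassBState d ρ β where
  μ := μ
  isProbabilityMeasure := isProbabilityMeasure_of_mem_tiltedBoxLimitPoints ⟨M, Q, hM, hQ, h⟩
  translationInvariant := isZdTranslationInvariant_of_mem_tiltedBoxLimitPoints ρ hρ ⟨M, Q, hM, hQ, h⟩
  permInvariant σ := measurePreserving_configPerm_of_mem_tiltedBoxLimitPoints' ρ hij hρ ⟨M, Q, hM, hQ, h⟩
    (perm_fix_or_swap_of_two hij hd σ)
  reflectInvariant := reflectInvariant_of_mem_tiltedBoxLimitPoints ρ hij hρ ⟨M, Q, hM, hQ, h⟩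
  haarShift := isHaarShiftState_of_mem_tiltedBoxLimitPoints ρ hρ ⟨M, Q, hM, hQ, h⟩
  siteRP k := (siteRP_and_linkRP_of_isTiltedBoxLimitAlong_odd ρ hij hd hρ h hM hQ hodd k).1
  linkRP k := linkRP_all_of_mem_tiltedBoxLimitPoints ρ hij hd hρ ⟨M, Q, hM, hQ, h⟩ k
  diagRP a b hab := diagRP_all_of_mem_tiltedBoxLimitPoints ρ hij hd hρ hβ ⟨M, Q, hM, hQ, h⟩ a b hab

/-- The Class-B state of an odd-family limit point has that limit point as its measure. -/
@[simp] theorem classBStateOfTiltedOdd_μ (hij : i ≠ j) (hd : ∀ k : Fin d, k = i ∨ k = j) (hρ : Continuous ρ)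
    {β : ℝ} (hβ : 0 ≤ β) {M Q : ℕ → ℕ} {μ : Measure (LGConfig d G)}
    (h : IsTiltedBoxLimitAlong d i j ρ β M Q μ) (hM : Tendsto M atTop atTop) (hQ : Tendsto Q atTop atTop)
    (hodd : ∃ᶠ k in atTop, Odd (M k + 2)) :
    (classBStateOfTiltedOdd ρ hij hd hρ hβ h hM hQ hodd).μ = μ := rfl

/-- **Every two-dimensional tilted limit point along (frequently) odd boxes is a Class-B state**
(`β ≥ 0`). -/
theorem exists_classBState_eq_of_isTiltedBoxLimitAlong_odd (hij : i ≠ j) (hd : ∀ k : Fin d, k = i ∨ k = j)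
    (hρ : Continuous ρ) {β : ℝ} (hβ : 0 ≤ β) {M Q : ℕ → ℕ} {μ : Measure (LGConfig d G)}
    (h : IsTiltedBoxLimitAlong d i j ρ β M Q μ) (hM : Tendsto M atTop atTop) (hQ : Tendsto Q atTop atTop)
    (hodd : ∃ᶠ k in atTop, Odd (M k + 2)) :
    ∃ ω : ClassBState d ρ β, ω.μ = μ :=
  ⟨classBStateOfTiltedOdd ρ hij hd hρ hβ h hM hQ hodd, rfl⟩

/-- **In two dimensions the tilted route reaches Class B at every `β ≥ 0`**: some tilted limit point of
the plane `(i, j)` (one along odd boxes, part 16) is the measure of a `ClassBState d ρ β`. Unconditional: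
no uniqueness or strong-coupling hypothesis; compact Hausdorff second countable `G`, continuous `ρ`. -/
theorem exists_classBState_mem_tiltedBoxLimitPoints (hij : i ≠ j) (hd : ∀ k : Fin d, k = i ∨ k = j)
    (hρ : Continuous ρ) {β : ℝ} (hβ : 0 ≤ β) :
    ∃ ω : ClassBState d ρ β, ω.μ ∈ tiltedBoxLimitPoints d i j ρ β := by
  obtain ⟨μ, M, Q, hM, hQ, h, hodd⟩ := exists_isTiltedBoxLimitAlong_odd (d := d) (i := i) (j := j) ρ hρ β
  exact ⟨classBStateOfTiltedOdd ρ hij hd hρ hβ h hM hQ (Frequently.of_forall hodd), ⟨M, Q, hM, hQ, h⟩⟩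

/-- **`ClassBState d ρ β` is inhabited in two dimensions at every `β ≥ 0`, via tilted boxes.** -/
theorem nonempty_classBState_of_two (hij : i ≠ j) (hd : ∀ k : Fin d, k = i ∨ k = j) (hρ : Continuous ρ)
    {β : ℝ} (hβ : 0 ≤ β) : Nonempty (ClassBState d ρ β) :=
  let ⟨ω, _⟩ := exists_classBState_mem_tiltedBoxLimitPoints (d := d) ρ hij hd hρ hβ
  ⟨ω⟩

/-- **The statement on `ℤ²`, literally** (`d = 2`, axes `0`, `1`): at every `β ≥ 0` some limit point of
the Wilson states of the tilted boxes `ℤ²/Γ(M+2, M+2, 2(Q+2))` is a Class-B state of two-dimensional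
lattice gauge theory. -/
theorem exists_classBState_tilted_fin_two (hρ : Continuous ρ) {β : ℝ} (hβ : 0 ≤ β) :
    ∃ ω : ClassBState 2 ρ β, ω.μ ∈ tiltedBoxLimitPoints 2 (0 : Fin 2) 1 ρ β :=
  exists_classBState_mem_tiltedBoxLimitPoints ρ Fin.zero_ne_one (fun k => by fin_cases k <;> simp) hρ hβ

end TiltedRP

end Summit.QuantumFields.GaugeBoot

end
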